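import Summits.HodgeConjecture.HodgeConjecture.Theorems.R90S6HeckeCoeffOrbit
import Summits.HodgeConjecture.HodgeConjecture.Theorems.R90S6MulEquivFixesDoubleCosets
import HarnessLib

/-!
# R90 · S6 «Ch. 14.1–14.5 stable trace formula» — WAVE 7 card W7-a.4 («eG-INDEPENDENCE», THE SOCKET COROLLARY):
# `g ↦ (φ [K₀])((e g) K₀)` does not depend on the transport `e` (`Theorems/R90S6HeckeCoeffIndepOfIso.lean`)

Cell `hodgecm-mathlib`, crux H413 (`stmt-HodgeConjecture-24833`), route of record `HCCMUnconditional`; programme R90-TF,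
section S6 (base `R90-C14`), seat R90-C14-p06 (g0); S6 WAVE 7 (R90-C14-plan (g2), R90 bus 2026-09-04T23:08:14Z ∕ 23:10:40Z ∕
23:14:13Z), card W7-a.4 of the typist's sheet `R90/R90-C14-typ1/g2/S6_wave7_targets.v1.712f4079a2a1dc1c.lean` :106–:111
(signature token-identical; namespace segment `.Wave7` dropped, as for W3∕W6).  Helper lane
`--supports stmt-HodgeConjecture-24833 --as helper`; THEOREMS ONLY (no definition, no instance, no notation, no named fact,
no `sorry`); imports = ★ `Theorems/R90S6HeckeCoeffOrbit` (W7-a.1) + ★ `Theorems/R90S6MulEquivFixesDoubleCosets` (W7-a.3) +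
HarnessLib (no Lines import).

CONTENT (pure group theory, generic coefficient ring `k`).  S6 D's sockets `StubR90ExtE1HeckeFL`
(`Cruxes/H413/Lines/R90_S6_FloorE1D.lean` :298–:308) and S4's `StubR90ExtE1TwistedTransferFL` (conjunct 2) are ∀-bound over a
transport `eG : U(H′)(L⁺_v) ≃ₜ* U(J₀,3)(L_w)` carrying the integral level onto the hyperspecial `K₀` («K-law»
`∀ g, eG g ∈ K₀ ↔ g ∈ K_v`) and read a spherical `φ ∈ ℋ(U, K₀)` as `g ↦ heckeToFun K₀ φ (eG g) = (φ [K₀]).coeff ((eG g) K₀)`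
(D :219–:220, `rfl`; `≃ₜ*` coerces to `≃*`).  THIS FILE: for groups `Gv`, `U`, subgroups `Kv ≤ Gv`, `K₀ ≤ U` such that the index
separates the `K₀`-double cosets of `U` (`hsep`, paid on path by W7-e), any two isomorphisms `e e' : Gv ≃* U` with the K-law and
any `T ∈ ℋ(U, K₀)` give the SAME function `g ↦ (T [K₀])((e g)K₀)` — so the assembly E1.3.9 may fix ONE transport, without
Borel–Tits rigidity.  Proof (5 lines): `θ := e.symm.trans e'` is an automorphism of `U` with the `K₀`-law; W7-a.3 gives
`θ(u)K₀ ∈ K₀ · uK₀` at `u := e g`, where `θ (e g) = e' g`; W7-a.1 concludes.  Fourth of the four «eG-independence» lemmas.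

* **`coeff_toVector_comp_eq_of_memLaw`** — W7-a.4.

HONEST LABEL: a helper theorem, count-neutral until the E1.3.9 assembly consumes it; HC_CM is proved only modulo the
7 printed citations (2 remaining named inputs: hLiu418 = stmt-HodgeConjecture-24832, h413 = stmt-HodgeConjecture-24833)
until rung 0 closes; REL ≠ ★ ≠ BUILT.

## References
* [CartierCorvallis1979] P. Cartier, *Representations of 𝔭-adic groups: a survey*, PSPM 33.1 (1979), §I.3–I.4, §IV.1.
* [ShimuraIATAF1971] G. Shimura, *Introduction to the arithmetic theory of automorphic functions* (1971), §3.1.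
-/

set_option autoImplicit false
-- the mandated namespace repeats the single-problem summit's segment (`HodgeConjecture.HodgeConjecture`)
set_option linter.dupNamespace false

noncomputable section

open MulAction MonoidAlgebra
open Literature.NumberTheory.Automorphic

namespace Summit.HodgeConjecture.HodgeConjecture.R90.S6

variable {k : Type*} [CommRing k]

/-- **W7-a.4** `coeff_toVector_comp_eq_of_memLaw` («eG-independence»): for groups `Gv`, `U`, subgroups `Kv ≤ Gv`, `K₀ ≤ U` such
that the index separates the `K₀`-double cosets of `U` (`hsep`), any two isomorphisms `e e' : Gv ≃* U` with the K-law
`e g ∈ K₀ ↔ g ∈ Kv` (both) and any `T ∈ ℋ(U, K₀)` give the SAME function `g ↦ (T [K₀])((e g)K₀)` on `Gv` — so the ∀-bound `eG`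
(resp. `eH`) of `StubR90ExtE1HeckeFL` (S6 D :298–:308; `heckeToFun K₀ φ (eG g)` is this coefficient by `rfl`) and of
`StubR90ExtE1TwistedTransferFL` conjunct 2 reduce to ONE transport.  Proof: `θ := e.symm.trans e'` has the `K₀`-law; W7-a.3 at
`u := e g` (`θ (e g) = e' g`); W7-a.1. [folklore] -/
theorem coeff_toVector_comp_eq_of_memLaw {Gv U : Type*} [Group Gv] [Group U] (Kv : Subgroup Gv) (K₀ : Subgroup U)
    (hsep : ∀ u u' : U, (orbit K₀ (u : U ⧸ K₀)).ncard = (orbit K₀ (u' : U ⧸ K₀)).ncard → (u' : U ⧸ K₀) ∈ orbit K₀ (u : U ⧸ K₀))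
    (e e' : Gv ≃* U) (he : ∀ g, e g ∈ K₀ ↔ g ∈ Kv) (he' : ∀ g, e' g ∈ K₀ ↔ g ∈ Kv) (T : heckeAlgebra k U K₀) :
    (fun g : Gv => (heckeAlgebra.toVector K₀ T).coeff ((e' g : U) : U ⧸ K₀)) =
      fun g : Gv => (heckeAlgebra.toVector K₀ T).coeff ((e g : U) : U ⧸ K₀) := by
  funext g
  -- `θ := e⁻¹ ∘ e' : U ≃* U` satisfies the `K₀`-law
  have hθ : ∀ u, (e.symm.trans e') u ∈ K₀ ↔ u ∈ K₀ := fun u => by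
    rw [MulEquiv.trans_apply, he', ← he (e.symm u), MulEquiv.apply_symm_apply]
  -- W7-a.3 at `u := e g`: `(e' g) K₀ ∈ K₀ · (e g) K₀`
  have hmem := mk_mulEquiv_mem_orbit_of_ncard_separates K₀ (e.symm.trans e') hθ hsep (e g)
  rw [MulEquiv.trans_apply, MulEquiv.symm_apply_apply] at hmem
  -- W7-a.1: coefficients of `T [K₀]` are constant on `K₀`-orbits
  exact coeff_toVector_eq_of_mem_orbit K₀ T hmem

end Summit.HodgeConjecture.HodgeConjecture.R90.S6

end
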